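import Summits.QuantumFields.YangMills.Theorems.PencilRigidityWeakCouplingHypercubicLimitDecayTransfer
import Summits.QuantumFields.YangMills.Theorems.PencilRigidityWeakCouplingHypercubicLimitSeparatedDensity
import Summits.QuantumFields.YangMills.Theorems.LangevinControlUVOSLegsFromFemtoAndGapStubAssemblyRPPositivity
import HarnessLib

/-!
# Crux `WeakCouplingHypercubicLimit` (stmt-QuantumFields-16120), line `Sketch`, r10: `stub_rpPosOfPlaneLimits` — reflection
# positivity of Wilson's torus state ⇒ `RPPos` of the continuum limit family `planeSum T`

The registered stub Z3b-RP of the skeleton `Cruxes/WeakCouplingHypercubicLimit/Lines/Sketch.lean`.  For a finite tuple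
`P j` of test functions compactly supported at `δⱼ`-SEPARATED points with times in `[τⱼ, ρⱼ]` (the dense class of
`separatedDensity_of_isOffDiagonal`), the Osterwalder–Seiler square of the smeared renormalised plane-string fields
`X_k = Σⱼ Φ_k((c_k a_k⁴)^{deg j} • P j)` on the odd torus is non-negative (`rpSquare_fieldObs_nonneg`, eventually in `k`: `L_k ≥ 1`,
`β_k ≥ 0`), splits into the pair pairings `E_k[conj Φ_k(P i)(ΘU) · Φ_k(P j)(U)]` (`rpSquare_eq_sum_pairs`), and each pairing
converges along the `PlaneLimits` subsequence to `planeSum T (deg i + deg j) (ΘPᵢ* ⊗ Pⱼ)` (`tendsto_rpPair` of `…DecayTransfer`);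
so the continuum OS form of the tuple is non-negative (`rpPos_separated`).  General positive-time off-diagonal tuples follow by
density (`separatedDensity_of_isOffDiagonal`, `exists_time_floor`, `exists_radius`) and the joint continuity of the OS pairing
(`SchwartzMap.tendsto_appendTensor`, `continuous_osAdjoint`) — `stub_rpPosOfPlaneLimits`.

Refs: OsterwalderSeiler1978 §§2–3; OsterwalderSchrader1973 §4 (E2).
-/

noncomputable section

open scoped SchwartzMap BigOperators ComplexConjugate
open MeasureTheory Filter Topology
open Literature.MathematicalPhysics.QuantumFieldTheory Literature.MathematicalPhysics.QuantumLattice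
open Literature.MathematicalPhysics.AQFT
open Literature.Probability.LatticeModels (box Site)
open Summit.QuantumFields.YangMills.Cruxes.HypercubicLimit.CouplingResponse
open Summit.QuantumFields.YangMills.Cruxes.OSLegsFromFemtoAndGap.DlrCollarTransfer (plane conn Decay RPPos ConnCS)
open Summit.QuantumFields.YangMills.Cruxes.OSLegsAtWeakCouplingC.Sketch (Separated)
open Summit.QuantumFields.YangMills.Theorems.OSLegsFromFemtoAndGap

namespace Summit.QuantumFields.YangMills.Theorems.WeakCouplingHypercubicLimit.TraceNormColdPressure

variable {G : Type} [Group G] [TopologicalSpace G] [IsTopologicalGroup G] [CompactSpace G]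
  [MeasurableSpace G] [BorelSpace G]

/-! ### The reflection-positivity square of a tuple as the double sum of pair pairings -/

/-- **The Osterwalder–Seiler square of a tuple of smeared fields is the double sum of the pair pairings**:
`E[conj (Σⱼ Xⱼ(ΘU)) · Σⱼ Xⱼ(U)] = Σᵢⱼ E[conj Xᵢ(ΘU) · Xⱼ(U)]` — both sides expand into the same string weights
(`wilsonExpectation_rpSquare_eq`, `rpPair_expansion`). [folklore] -/
theorem rpSquare_eq_sum_pairs (r : LatticeRep G) (β : ℝ) (L : ℕ) (a : ℝ) {N : ℕ} {deg : Fin N → ℕ}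
    (F : (j : Fin N) → 𝓢((Fin (deg j) → EuclideanSpace ℝ (Fin 4)), ℂ)) (m : Fin 4 × Fin 4 → ℝ) :
    wilsonExpectation (d := 4) (L := 2 * L + 1) r.ρ β (fun U =>
        conj (∑ j, fieldObs r L a (F j) m U.timeReflect) * ∑ j, fieldObs r L a (F j) m U) =
      ∑ i, ∑ j, ∫ U, conj (fieldObs r L a (F i) m (GaugeConfig.timeReflect U)) * fieldObs r L a (F j) m U
        ∂(wilsonMeasure r.ρ β : Measure (GaugeConfig 4 (2 * L + 1) G)) := by
  rw [wilsonExpectation_rpSquare_eq]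
  refine Finset.sum_congr rfl fun i _ => Finset.sum_congr rfl fun j _ => ?_
  exact (rpPair_expansion G r β L a (deg i) (deg j) (F i) (F j) m).symm

/-! ### Reflection positivity of the limit on separated tuples -/

section Separated

variable (r : LatticeRep G) (sch : SpeciesScheme (YMSpecies G)) (φ : ℕ → ℕ) (hφ : StrictMono φ)
  (T : (n : ℕ) → (Fin n → Plane) → (𝓢((Fin n → EuclideanSpace ℝ (Fin 4)), ℂ) →L[ℂ] ℂ))
  (hβ : ∀ᶠ k in atTop, 0 ≤ sch.β k) (hUFB : UniformFunctionalBoundPlanes r sch) (hPL : PlaneLimits r sch φ T)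

include hφ hβ hUFB hPL

/-- **Reflection positivity of the limit family on SEPARATED tuples.**  For a finite tuple of test functions compactly
supported at `δⱼ`-separated points with times in `[τⱼ, ρⱼ]` (`τⱼ, δⱼ > 0`), the continuum OS form
`Σᵢⱼ planeSum T (deg i + deg j) (ΘPᵢ* ⊗ Pⱼ)` is real and non-negative: it is the limit along `φ` of the Osterwalder–Seiler
squares of the smeared renormalised fields (`rpSquare_eq_sum_pairs` + `tendsto_rpPair`), which are non-negative as soon as
`L_{φk} ≥ 1` and `β_{φk} ≥ 0` (`rpSquare_fieldObs_nonneg`; the smeared test functions vanish at non-positive lattice times by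
the time floors). [folklore] -/
theorem rpPos_separated {N : ℕ} {deg : Fin N → ℕ}
    (P : (j : Fin N) → 𝓢((Fin (deg j) → EuclideanSpace ℝ (Fin 4)), ℂ)) {ρ τ δ : Fin N → ℝ}
    (hτ : ∀ j, 0 < τ j) (hδ : ∀ j, 0 < δ j)
    (hPρ : ∀ j, tsupport (P j : (Fin (deg j) → EuclideanSpace ℝ (Fin 4)) → ℂ) ⊆ Metric.closedBall 0 (ρ j))
    (hPτ : ∀ j, tsupport (P j : (Fin (deg j) → EuclideanSpace ℝ (Fin 4)) → ℂ) ⊆ {u | ∀ l, τ j ≤ u l 0})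
    (hPδ : ∀ j, tsupport (P j : (Fin (deg j) → EuclideanSpace ℝ (Fin 4)) → ℂ) ⊆ Separated (deg j) (δ j)) :
    0 ≤ (∑ i, ∑ j, planeSum T (deg i + deg j) ((osAdjoint (P i)).appendTensor (P j))).re ∧
      (∑ i, ∑ j, planeSum T (deg i + deg j) ((osAdjoint (P i)).appendTensor (P j))).im = 0 := by
  classical
  -- the Osterwalder–Seiler squares of the smeared renormalised fields at the subsequence steps
  obtain ⟨pk, hpk⟩ : ∃ pk : ℕ → ℂ, pk = fun k =>
      wilsonExpectation (d := 4) (L := 2 * sch.L (φ k) + 1) r.ρ (sch.β (φ k)) fun U =>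
        conj (∑ j, fieldObs r (sch.L (φ k)) (sch.a (φ k))
            ((((sch.c r.curvature (φ k) * sch.a (φ k) ^ 4) ^ deg j : ℝ) : ℂ) • P j)
            (fun _ => sch.m r.curvature (φ k) / 6) U.timeReflect) *
          ∑ j, fieldObs r (sch.L (φ k)) (sch.a (φ k))
            ((((sch.c r.curvature (φ k) * sch.a (φ k) ^ 4) ^ deg j : ℝ) : ℂ) • P j)
            (fun _ => sch.m r.curvature (φ k) / 6) U := ⟨_, rfl⟩
  -- (1) the squares are eventually non-negative
  have haL : Tendsto (fun k => sch.a (φ k) * sch.L (φ k)) atTop atTop := sch.tendsto_L.comp hφ.tendsto_atTop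
  have hL1 : ∀ᶠ k in atTop, 1 ≤ sch.L (φ k) := by
    filter_upwards [haL.eventually (eventually_gt_atTop 0)] with k hk
    have hL0 : (0 : ℝ) < sch.L (φ k) := pos_of_mul_pos_right hk (sch.a_pos (φ k)).le
    exact Nat.one_le_iff_ne_zero.2 fun h => by simp [h] at hL0
  have hβφ : ∀ᶠ k in atTop, 0 ≤ sch.β (φ k) := hφ.tendsto_atTop.eventually hβ
  have hvan : ∀ (k : ℕ) (j : Fin N) (y : Fin (deg j) → Site 4), (∃ l, y l 0 ≤ 0) →
      ((((sch.c r.curvature (φ k) * sch.a (φ k) ^ 4) ^ deg j : ℝ) : ℂ) • P j) (fun l => sch.a (φ k) • siteToE (y l)) = 0 := by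
    rintro k j y ⟨l, hl⟩
    show (_ : ℂ) • P j (fun l => sch.a (φ k) • siteToE (y l)) = 0
    rw [OSLegsFromFemtoAndGap.apply_eq_zero_of_time (sch.a_pos (φ k)) (P j)
      (apply_eq_zero_of_time (hτ j) (hPρ j) (hPτ j)) y ⟨l, Or.inl hl⟩, smul_zero]
  have hp : ∀ᶠ k in atTop, 0 ≤ (pk k).re ∧ (pk k).im = 0 := by
    filter_upwards [hL1, hβφ] with k hk1 hk2
    rw [hpk]
    exact rpSquare_fieldObs_nonneg r hk1 hk2 (sch.a (φ k))
      (fun j => (((sch.c r.curvature (φ k) * sch.a (φ k) ^ 4) ^ deg j : ℝ) : ℂ) • P j) (hvan k)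
      (fun _ => sch.m r.curvature (φ k) / 6)
  -- (2) the squares converge to the continuum OS form of the tuple, pair by pair
  have hz : Tendsto pk atTop
      (𝓝 (∑ i, ∑ j, planeSum T (deg i + deg j) ((osAdjoint (P i)).appendTensor (P j)))) := by
    rw [hpk]
    simp only [rpSquare_eq_sum_pairs]
    refine tendsto_finsetSum _ fun i _ => tendsto_finsetSum _ fun j _ => ?_
    have h := tendsto_rpPair r sch φ hφ T hUFB hPL (hτ i) (hδ i) (hPρ i) (hPτ i) (hPδ i) (P j)
      (posSep_of_separated (hδ j) (hτ j) (hPδ j) (hPτ j)) (fun _ => 0) 0 tendsto_const_nhds (fun _ => le_rfl)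
    simp only [translateMulti_zero_eq] at h
    exact h
  -- (3) positivity passes to the limit
  exact nonneg_of_tendsto_of_near hz hp tendsto_const_nhds (Eventually.of_forall fun k => by rw [sub_self, norm_zero])

end Separated

/-! ### The registered stub: `RPPos (planeSum T)` by density -/

/-- `stub_rpPosOfPlaneLimits` (Z3b-RP, line `Sketch`, r10; registered) — **reflection positivity of the limit on positive-time
off-diagonal tuples** (`RPPos (planeSum T)`).  Osterwalder–Seiler positivity of Wilson's measure on the odd torus (`β_k ≥ 0`
eventually) for the smeared plane-string functionals of test functions compactly supported at pairwise SEPARATED points gives the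
non-negativity of the continuum OS form on separated tuples (`rpPos_separated`: there the reflected functional is an exact finite sum
of `planeDist`'s of `O(a_k)`-shifted test functions staying in `⁰𝒮`, `tendsto_rpPair`); general positive-time off-diagonal tuples by
the separated density with support control (`separatedDensity_of_isOffDiagonal`: the approximants are supported inside `tsupport Fⱼ`,
hence at positive times, with time floors / radii `exists_time_floor` / `exists_radius`) and the joint continuity of the OS pairing
(`SchwartzMap.tendsto_appendTensor`, `continuous_osAdjoint`; pattern `isReflectionPositive_of_softLimit`). [folklore] -/
theorem stub_rpPosOfPlaneLimits :
    ∀ (G : Type) [Group G] [TopologicalSpace G] [IsTopologicalGroup G] [CompactSpace G]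
      [MeasurableSpace G] [BorelSpace G] (r : LatticeRep G) (sch : SpeciesScheme (YMSpecies G))
      (φ : ℕ → ℕ) (hφ : StrictMono φ)
      (T : (n : ℕ) → (Fin n → Plane) → (𝓢((Fin n → EuclideanSpace ℝ (Fin 4)), ℂ) →L[ℂ] ℂ)),
      (∀ᶠ k in atTop, 0 ≤ sch.β k) → UniformFunctionalBoundPlanes r sch → PlaneLimits r sch φ T →
        RPPos (planeSum T) := by
  intro G _ _ _ _ _ _ r sch φ hφ T hβ hUFB hPL N deg F hpos hoff H hH
  classical
  intro z
  -- separated, compactly supported approximants inside the supports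
  choose u hu_c hu_sep hu_supp _hu_real hu_lim using fun j => separatedDensity_of_isOffDiagonal (deg j) (F j) (hoff j)
  -- the approximating OS forms are non-negative
  have hstep : ∀ m : ℕ,
      0 ≤ (∑ i, ∑ j, planeSum T (deg i + deg j) ((osAdjoint (u i m)).appendTensor (u j m))).re ∧
        (∑ i, ∑ j, planeSum T (deg i + deg j) ((osAdjoint (u i m)).appendTensor (u j m))).im = 0 := by
    intro m
    have hposm : ∀ j, tsupport (u j m : (Fin (deg j) → EuclideanSpace ℝ (Fin 4)) → ℂ) ⊆ {v | ∀ l, 0 < v l 0} :=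
      fun j v hv => hpos j (hu_supp j m hv)
    choose τ hτ hFτ using fun j => exists_time_floor (hu_c j m) (hposm j)
    choose ρ _hρ hFρ using fun j => exists_radius (hu_c j m)
    choose δ hδ hFδ using fun j => hu_sep j m
    exact rpPos_separated r sch φ hφ T hβ hUFB hPL (fun j => u j m) hτ hδ hFρ hFτ hFδ
  -- and converge to the OS form of the tuple
  have hHeq : ∀ i j, H i j = (osAdjoint (F i)).appendTensor (F j) := fun i j => by
    ext x; rw [hH i j x, SchwartzMap.appendTensor_apply]
  have hconv : Tendsto (fun m => ∑ i, ∑ j, planeSum T (deg i + deg j) ((osAdjoint (u i m)).appendTensor (u j m))) atTop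
      (𝓝 z) := by
    refine tendsto_finsetSum _ fun i _ => tendsto_finsetSum _ fun j _ => ?_
    rw [hHeq i j]
    exact ((planeSum T (deg i + deg j)).continuous.tendsto _).comp
      (SchwartzMap.tendsto_appendTensor ((continuous_osAdjoint.tendsto _).comp (hu_lim i)) (hu_lim j))
  have hre := (Complex.continuous_re.tendsto _).comp hconv
  have him := (Complex.continuous_im.tendsto _).comp hconv
  exact ⟨ge_of_tendsto' hre fun m => (hstep m).1,
    tendsto_nhds_unique him (tendsto_const_nhds.congr fun m => ((hstep m).2).symm)⟩

end Summit.QuantumFields.YangMills.Theorems.WeakCouplingHypercubicLimit.TraceNormColdPressure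

end
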